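import Literature.MathematicalPhysics.QuantumLattice.TranslationInvariantGroundStates
import Literature.MathematicalPhysics.QuantumLattice.InfiniteVolumeStatesDerivationProofs
import Literature.MathematicalPhysics.QuantumLattice.InfiniteVolumeShiftProofs
import Literature.MathematicalPhysics.QuantumLattice.MeanEnergyMinimisersAreGroundStates
import HarnessLib

/-!
# The sparse Kraus perturbation of an infinite-volume state of a quantum SPIN system, and its
# translation-invariant cell average

Topic `Literature/MathematicalPhysics/QuantumLattice`; namespace
`Literature.MathematicalPhysics.QuantumLattice` (the file path). Vocabulary of `InfiniteVolumeStates.lean`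
(quantum spin systems on `ℤ^d`, local dimension `q`: `Op ↥Λ q`, `embedOp`, `transportOp`, `InfVolState`,
`InfVolState.shift`, `InfVolState.IsTranslationInvariant`) and of `TranslationInvariantGroundStates.lean`
(`InfVolState.meanEnergy`). Everything is a definition with a body or a PROVED theorem; no named fact.
This is the spin-system twin of the tree's FERMIONIC files `FermionKrausPerturbation.lean`,
`SparseKrausPerturbedState.lean` and `SparseKrausPerturbedStateShift.lean` (the state-level half of the
local-perturbation argument behind Bratteli–Kishimoto–Robinson 1978 Thm. 2 `2 ⇒ 1` / Ruelle 1969), with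
plain locality in place of graded locality; the purely lattice-combinatorial part of those files (the
sparse sublattices `x ≡ r (mod a)`, `touch`, `hull`, `residue`, `allTouch` and their lemmas, stated there
for a `KrausPattern`) is REUSED through the skeleton `SpinKrausPattern.sk : KrausPattern d` (same region
`Λ₀` and spacing `a`, trivial Kraus family), not restated.

* §1 `krausMapOp W` — the completely positive map `B ↦ Σ_k W_k⋆ B W_k` of a finite family `W_k ∈ 𝔄_{Λ'}`
  (unital when `Σ W_k⋆W_k = 𝟙`; fixes every `B` commuting with the `W_k`; positivity; covariance under
  isotony and transport; two such maps with commuting families commute).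
* §2 `SpinKrausPattern d q` — the data `(Λ₀, V, a)`: a finite Kraus family `V_k ∈ 𝔄_{Λ₀}`,
  `Σ V_k⋆V_k = 𝟙`, and a spacing `a` exceeding the extent of `Λ₀`; `placed x h k ∈ 𝔄_{Λ'}` = `V_k`
  translated to `x + Λ₀ ⊆ Λ'`.
* §3 `localMap`, `sparseMap` (the commuting product of the local Kraus maps over the sparse translates
  meeting a region, a `Finset.noncommProd` in `Module.End`), §4 `sparseState P r ω : InfVolState d q`
  (the state `ω` perturbed simultaneously at all translates `x + Λ₀`, `x ≡ r (mod a)`) — compatibility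
  along `Λ ⊆ Λ'` because the extra translates fix the observables of `Λ` (locality).
* §5 `shift_sparseState` — covariance `(sparseState r ω) ∘ τ_v = sparseState (r − v̄) ω` for a
  translation-invariant `ω`; §6 `InfVolState.avgState`, `cellState` (the average over all residue
  classes `r ∈ (ℤ/aℤ)^d`) and `cellState_isTranslationInvariant`.

## References

* [BratteliKishimotoRobinson1978] O. Bratteli, A. Kishimoto, D. W. Robinson, *Ground states of quantum
  spin systems*, Commun. Math. Phys. 64 (1978) 41–48, proof of Thm. 1 (local completely positive
  perturbations `ω ∘ e^{tγ_B}`) and Thm. 2.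
* [Ruelle1969GroundState] D. Ruelle, Commun. Math. Phys. 11 (1969) 339–345, §2 and Thm. 2.
* [BratteliRobinsonII1997] O. Bratteli, D. W. Robinson, OAQSM 2, §6.2.1 (locality, isotony, translations),
  §5.3.1 (completely positive maps `B⋆(·)B`).
* [BratteliRobinsonI1987] OAQSM 1, §4.3.1 (invariant states, averaging).
-/

noncomputable section

namespace Literature.MathematicalPhysics.QuantumLattice

open Matrix Finset Literature.Probability.LatticeModels
open scoped ComplexOrder

variable {d q : ℕ}

/-! ### §0. Generic facts: commuting products of endomorphisms; placements along equal regions -/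

section NoncommProd

variable {α α' : Type*} {M M' : Type*} [AddCommMonoid M] [Module ℂ M] [AddCommMonoid M'] [Module ℂ M']

/-- A commuting product of endomorphisms each fixing `v` fixes `v`. [folklore] -/
private theorem noncommProd_apply_eq_self (s : Finset α) (f : α → Module.End ℂ M) (comm)
    {v : M} (h : ∀ x ∈ s, f x v = v) : s.noncommProd f comm v = v := by
  refine Finset.noncommProd_induction s f comm (fun Φ => Φ v = v) (fun Φ Ψ hΦ hΨ => ?_) rfl h
  rw [Module.End.mul_apply, hΨ, hΦ]

/-- A commuting product of endomorphisms preserving a predicate preserves it. [folklore] -/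
private theorem noncommProd_apply_induction (s : Finset α) (f : α → Module.End ℂ M) (comm)
    (p : M → Prop) (h : ∀ x ∈ s, ∀ X, p X → p (f x X)) (X : M) (hX : p X) :
    p (s.noncommProd f comm X) := by
  have key : ∀ Y, p Y → p (s.noncommProd f comm Y) :=
    Finset.noncommProd_induction s f comm (fun Φ => ∀ Y, p Y → p (Φ Y))
      (fun Φ Ψ hΦ hΨ Y hY => by rw [Module.End.mul_apply]; exact hΦ _ (hΨ _ hY)) (fun Y hY => hY) h
  exact key X hX

/-- **Intertwining a commuting product**: if `L (f x X) = g x (L X)` for all `x ∈ s`, then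
`L (∏_{x∈s} f x X) = ∏_{x∈s} g x (L X)`. [folklore] -/
private theorem apply_noncommProd_apply (L : M → M') (s : Finset α) (f : α → Module.End ℂ M)
    (g : α → Module.End ℂ M') (hf) (hg) (h : ∀ x ∈ s, ∀ X, L (f x X) = g x (L X)) (X : M) :
    L (s.noncommProd f hf X) = s.noncommProd g hg (L X) := by
  induction s using Finset.cons_induction_on generalizing X with
  | empty => rw [Finset.noncommProd_empty, Finset.noncommProd_empty, Module.End.one_apply, Module.End.one_apply]
  | cons a s ha IH =>
    rw [Finset.noncommProd_cons, Finset.noncommProd_cons, Module.End.mul_apply, Module.End.mul_apply,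
      h a (Finset.mem_cons_self a s), IH _ _ (fun x hx => h x (Finset.mem_cons_of_mem hx))]

/-- **Intertwining a commuting product along a reindexing**: if `L (f x X) = g (e x) (L X)` for `x ∈ s`,
then `L (∏_{x∈s} f x X) = ∏_{y ∈ e(s)} g y (L X)`. [folklore] -/
private theorem apply_noncommProd_apply_map (L : M → M') (s : Finset α) (e : α ↪ α')
    (f : α → Module.End ℂ M) (g : α' → Module.End ℂ M') (hf) (hg)
    (h : ∀ x ∈ s, ∀ X, L (f x X) = g (e x) (L X)) (X : M) :
    L (s.noncommProd f hf X) = (s.map e).noncommProd g hg (L X) := by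
  induction s using Finset.cons_induction_on generalizing X with
  | empty =>
    simp only [Finset.map_empty]
    rw [Finset.noncommProd_empty, Finset.noncommProd_empty, Module.End.one_apply, Module.End.one_apply]
  | cons a s ha IH =>
    have hmap : (Finset.cons a s ha).map e = Finset.cons (e a) (s.map e) (by simpa using ha) :=
      Finset.map_cons e a s ha
    rw [Finset.noncommProd_cons, Finset.noncommProd_congr hmap (fun _ _ => rfl), Finset.noncommProd_cons,
      Module.End.mul_apply, Module.End.mul_apply, h a (Finset.mem_cons_self a s),
      IH _ _ (fun x hx => h x (Finset.mem_cons_of_mem hx))]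

end NoncommProd

/-- **A placed observable does not depend on the route of the placement**: transporting `A ∈ 𝔄_X`
into two EQUAL regions `S₁ = S₂ ⊆ Λ''` along relabellings that agree on the underlying sites gives the
same element of `𝔄_{Λ''}`. [cite: BratteliRobinsonII1997, §6.2.1 (covariance and isotony)] -/
theorem embedOp_transportOp_congr {X : Type*} [Fintype X] [DecidableEq X] {S₁ S₂ Λ'' : Finset (Site d)}
    (hS : S₁ = S₂) (h₁ : S₁ ⊆ Λ'') (h₂ : S₂ ⊆ Λ'') (E₁ : X ≃ ↥S₁) (E₂ : X ≃ ↥S₂)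
    (hE : ∀ y, (E₁ y : Site d) = E₂ y) (A : Matrix (X → Fin q) (X → Fin q) ℂ) :
    embedOp h₁ (transportOp E₁ A) = embedOp h₂ (transportOp E₂ A) := by
  subst hS
  have hEE : E₁ = E₂ := Equiv.ext fun y => Subtype.ext (hE y)
  subst hEE
  rfl

/-- The relabelling of a region onto its translate `Λ + v = shiftSet v Λ`, `y ↦ y + v` (the tree's
`finsetMapEquiv (Site.shift v).toEmbedding Λ`, typed in the `shiftSet` idiom of the sparse-sublattice
combinatorics). [cite: BratteliRobinsonII1997, §6.2.1 (eq. (6.2.2))] -/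
def siteShiftEquiv (v : Site d) (Λ : Finset (Site d)) : ↥Λ ≃ ↥(shiftSet v Λ) :=
  finsetMapEquiv (Site.shift v).toEmbedding Λ

/-- The underlying site of a translated point: `(siteShiftEquiv v Λ y : ℤ^d) = y + v`.
[cite: BratteliRobinsonII1997, §6.2.1 (eq. (6.2.2))] -/
@[simp] theorem coe_siteShiftEquiv_apply (v : Site d) (Λ : Finset (Site d)) (y : ↥Λ) :
    (siteShiftEquiv v Λ y : Site d) = (y : Site d) + v := rfl

/-- Translated regions are monotone: `Λ ⊆ Λ' → Λ + v ⊆ Λ' + v`.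
[cite: BratteliRobinsonII1997, §6.2.1 (lattice translations)] -/
theorem shiftSet_mono {Λ Λ' : Finset (Site d)} (h : Λ ⊆ Λ') (v : Site d) : shiftSet v Λ ⊆ shiftSet v Λ' :=
  Finset.map_subset_map.2 h

/-- **Lattice translations commute with isotony** (the tree's `transportOp_shift_embedOp` in the `shiftSet`
idiom): `τ_v (A ⊗ 𝟙_{Λ'∖Λ}) = τ_v(A) ⊗ 𝟙_{(Λ'+v)∖(Λ+v)}`. [cite: BratteliRobinsonII1997, §6.2.1 (eq. (6.2.2))] -/
theorem transportOp_shiftSet_embedOp {Λ Λ' : Finset (Site d)} (h : Λ ⊆ Λ') (v : Site d) (A : Op ↥Λ q) :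
    transportOp (siteShiftEquiv v Λ') (embedOp h A) =
      embedOp (shiftSet_mono h v) (transportOp (siteShiftEquiv v Λ) A) :=
  transportOp_shift_embedOp h v A

/-- The translate of an infinite-volume state, on the translate `Λ + v = shiftSet v Λ` of a region
(`InfVolState.shift_expect` in the `shiftSet` idiom; definitional). [cite: BratteliRobinsonII1997, §6.2.1 (eq. (6.2.2))] -/
theorem InfVolState.shift_expect_shiftSet (ω : InfVolState d q) (v : Site d) (Λ : Finset (Site d))
    (A : Op ↥Λ q) :
    (ω.shift v).expect Λ A = ω.expect (shiftSet v Λ) (transportOp (siteShiftEquiv v Λ) A) := rfl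

/-- A translation-invariant interaction at a translated region, in the `shiftSet` idiom:
`Φ (X + v) = τ_v (Φ X)`. [cite: BratteliRobinsonII1997, §6.2.1 (eq. (6.2.3))] -/
theorem LatticeInteraction.IsTranslationInvariant.apply_shiftSet {Φ : LatticeInteraction d q}
    (hT : Φ.IsTranslationInvariant) (v : Site d) (X : Finset (Site d)) :
    Φ (shiftSet v X) = transportOp (siteShiftEquiv v X) (Φ X) :=
  hT v X

/-! ### §1. Kraus maps of a finite family of local operators -/

section KrausMapOp

variable {Λ' Λ'' : Finset (Site d)} {ι κ : Type*} [Fintype ι] [Fintype κ]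

/-- **The Kraus map** `𝓔_W(B) = Σ_k W_k⋆ B W_k` of a finite family `W_k ∈ 𝔄_{Λ'}` (a completely positive
map of `𝔄_{Λ'}`, unital when `Σ_k W_k⋆ W_k = 𝟙`). Bratteli–Robinson II §5.3.1 (the maps `e^{tγ_B}`);
Bratteli–Kishimoto–Robinson 1978, proof of Thm. 1.
[cite: BratteliKishimotoRobinson1978, Thm. 1 (proof, the semigroup `e^{tγ_B}`)] -/
def krausMapOp (W : ι → Op ↥Λ' q) : Module.End ℂ (Op ↥Λ' q) where
  toFun B := ∑ k, (W k)ᴴ * B * W k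
  map_add' B C := by
    rw [← Finset.sum_add_distrib]
    exact Finset.sum_congr rfl fun k _ => by rw [Matrix.mul_add, Matrix.add_mul]
  map_smul' c B := by
    rw [RingHom.id_apply, Finset.smul_sum]
    exact Finset.sum_congr rfl fun k _ => by rw [Matrix.mul_smul, Matrix.smul_mul]

/-- `𝓔_W(B) = Σ_k W_k⋆ B W_k` (definitional). [cite: BratteliKishimotoRobinson1978, Thm. 1 (proof)] -/
theorem krausMapOp_apply (W : ι → Op ↥Λ' q) (B : Op ↥Λ' q) :
    krausMapOp W B = ∑ k, (W k)ᴴ * B * W k := rfl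

/-- **`𝓔_W` fixes every operator commuting with the Kraus operators** (given `Σ W_k⋆ W_k = 𝟙`):
`Σ_k W_k⋆ B W_k = (Σ_k W_k⋆ W_k) B = B`. [cite: BratteliRobinsonII1997, §5.3.1] -/
theorem krausMapOp_eq_self_of_commute {W : ι → Op ↥Λ' q} (hW : ∑ k, (W k)ᴴ * W k = 1)
    {B : Op ↥Λ' q} (hB : ∀ k, Commute (W k) B) : krausMapOp W B = B := by
  rw [krausMapOp_apply]
  calc ∑ k, (W k)ᴴ * B * W k = ∑ k, (W k)ᴴ * W k * B :=
        Finset.sum_congr rfl fun k _ => by rw [Matrix.mul_assoc, ← (hB k).eq, ← Matrix.mul_assoc]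
    _ = B := by rw [← Finset.sum_mul, hW, Matrix.one_mul]

/-- **`𝓔_W` is unital**: `𝓔_W(𝟙) = Σ_k W_k⋆ W_k = 𝟙`. [cite: BratteliRobinsonII1997, §5.3.1] -/
theorem krausMapOp_one {W : ι → Op ↥Λ' q} (hW : ∑ k, (W k)ᴴ * W k = 1) : krausMapOp W 1 = 1 :=
  krausMapOp_eq_self_of_commute hW fun _ => Commute.one_right _

/-- **Positivity**: `𝓔_W` maps positive semidefinite operators to positive semidefinite operators.
[cite: BratteliRobinsonII1997, §5.3.1 (complete positivity)] -/
theorem krausMapOp_posSemidef (W : ι → Op ↥Λ' q) {B : Op ↥Λ' q} (hB : B.PosSemidef) :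
    (krausMapOp W B).PosSemidef := by
  rw [krausMapOp_apply]
  exact Matrix.posSemidef_sum _ fun k _ => hB.conjTranspose_mul_mul_same _

open scoped MatrixOrder in
/-- Positivity in the Loewner order: `0 ≤ B → 0 ≤ 𝓔_W B`. [cite: BratteliRobinsonII1997, §5.3.1] -/
theorem krausMapOp_nonneg (W : ι → Op ↥Λ' q) {B : Op ↥Λ' q} (hB : 0 ≤ B) : 0 ≤ krausMapOp W B :=
  Matrix.nonneg_iff_posSemidef.2 (krausMapOp_posSemidef W (Matrix.nonneg_iff_posSemidef.1 hB))

/-- **Covariance under isotony and transport**: for `h : Λ' ⊆ Λ''`-type placements composed with a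
relabelling `e`, `Γ_h(τ_e(𝓔_W B)) = 𝓔_{Γ_h ∘ τ_e ∘ W}(Γ_h(τ_e B))`.
[cite: BratteliRobinsonII1997, §6.2.1 (isotony and covariance are `*`-homomorphisms)] -/
theorem embedOp_transportOp_krausMapOp {S Λ₃ : Finset (Site d)} (h : S ⊆ Λ₃) (e : ↥Λ' ≃ ↥S)
    (W : ι → Op ↥Λ' q) (B : Op ↥Λ' q) :
    embedOp h (transportOp e (krausMapOp W B)) =
      krausMapOp (fun k => embedOp h (transportOp e (W k))) (embedOp h (transportOp e B)) := by
  rw [krausMapOp_apply, krausMapOp_apply, transportOp_eq_reindexAlgEquiv, map_sum, embedOp_sum]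
  refine Finset.sum_congr rfl fun k _ => ?_
  rw [map_mul, map_mul, ← transportOp_eq_reindexAlgEquiv, ← transportOp_eq_reindexAlgEquiv,
    ← transportOp_eq_reindexAlgEquiv, transportOp_conjTranspose, embedOp_mul, embedOp_mul,
    embedOp_conjTranspose]

/-- **Covariance under isotony**: `Γ_h(𝓔_W B) = 𝓔_{Γ_h ∘ W}(Γ_h B)`.
[cite: BratteliRobinsonII1997, §6.2.1 (isotony)] -/
theorem embedOp_krausMapOp (h : Λ' ⊆ Λ'') (W : ι → Op ↥Λ' q) (B : Op ↥Λ' q) :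
    embedOp h (krausMapOp W B) = krausMapOp (fun k => embedOp h (W k)) (embedOp h B) := by
  rw [krausMapOp_apply, krausMapOp_apply, embedOp_sum]
  refine Finset.sum_congr rfl fun k _ => ?_
  rw [embedOp_mul, embedOp_mul, embedOp_conjTranspose]

/-- **Kraus maps with commuting Kraus families commute** (pointwise form):
`𝓔_W (𝓔_{W'} B) = 𝓔_{W'} (𝓔_W B)` when every `W_k` commutes with every `W'_j` (then also
`W_k⋆ W'_j⋆ = W'_j⋆ W_k⋆`). [cite: BratteliRobinsonII1997, §6.2.1 (locality)] -/
theorem krausMapOp_krausMapOp_comm {W : ι → Op ↥Λ' q} {W' : κ → Op ↥Λ' q}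
    (hc : ∀ k j, Commute (W k) (W' j)) (B : Op ↥Λ' q) :
    krausMapOp W (krausMapOp W' B) = krausMapOp W' (krausMapOp W B) := by
  simp only [krausMapOp_apply, Finset.mul_sum, Finset.sum_mul]
  rw [Finset.sum_comm]
  refine Finset.sum_congr rfl fun j _ => Finset.sum_congr rfl fun k _ => ?_
  have hmul : W' j * W k = W k * W' j := (hc k j).eq.symm
  have hct : (W k)ᴴ * (W' j)ᴴ = (W' j)ᴴ * (W k)ᴴ := by
    rw [← Matrix.conjTranspose_mul, ← Matrix.conjTranspose_mul, hmul]
  calc (W k)ᴴ * ((W' j)ᴴ * B * W' j) * W k = ((W k)ᴴ * (W' j)ᴴ) * B * (W' j * W k) := by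
        simp only [Matrix.mul_assoc]
    _ = ((W' j)ᴴ * (W k)ᴴ) * B * (W k * W' j) := by rw [hct, hmul]
    _ = (W' j)ᴴ * ((W k)ᴴ * B * W k) * W' j := by simp only [Matrix.mul_assoc]

/-- **Kraus maps with commuting Kraus families commute** in the endomorphism monoid of `𝔄_{Λ'}`.
[cite: BratteliRobinsonII1997, §6.2.1 (locality)] -/
theorem krausMapOp_comm {W : ι → Op ↥Λ' q} {W' : κ → Op ↥Λ' q} (hc : ∀ k j, Commute (W k) (W' j)) :
    Commute (krausMapOp W) (krausMapOp W') :=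
  LinearMap.ext fun B => krausMapOp_krausMapOp_comm hc B

end KrausMapOp

/-! ### §2. Spin Kraus patterns and placed Kraus operators -/

/-- **A Kraus pattern of a quantum spin system**: a finite region `Λ₀ ⊆ ℤ^d`, a finite Kraus family
`V_k ∈ 𝔄_{Λ₀}` (`Σ_k V_k⋆ V_k = 𝟙`), and a spacing `a` exceeding the extent of `Λ₀` in every coordinate
(so that the translates `x + Λ₀`, `x ≡ r (mod a)`, are pairwise disjoint). The local completely positive
perturbation of Bratteli–Kishimoto–Robinson's proof of their Thm. 1 (`ω ∘ e^{tγ_B}`), prepared for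
simultaneous application along a sparse sublattice (spin twin of the fermionic `KrausPattern`, without
the homogeneity condition). [cite: BratteliKishimotoRobinson1978, Thm. 1 (proof) and Thm. 2] -/
structure SpinKrausPattern (d q : ℕ) where
  /-- the support of the perturbation -/
  Λ₀ : Finset (Site d)
  /-- number of Kraus operators -/
  m : ℕ
  /-- the Kraus operators -/
  V : Fin m → Op ↥Λ₀ q
  /-- the spacing of the sparse sublattice -/
  a : ℕ
  /-- completeness `Σ V_k⋆ V_k = 𝟙` -/
  sum_conjTranspose_mul : ∑ k, (V k)ᴴ * V k = 1
  /-- the spacing exceeds the extent of `Λ₀` -/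
  sub_lt : ∀ x ∈ Λ₀, ∀ y ∈ Λ₀, ∀ i, x i - y i < a

namespace SpinKrausPattern

variable (P : SpinKrausPattern d q)

/-- **The sparse-sublattice skeleton** of a spin Kraus pattern: the fermionic `KrausPattern` with the same
region `Λ₀` and spacing `a` and the trivial Kraus family `(𝟙)`. Only its lattice combinatorics is used
(`KrausPattern.IsSparse/touch/hull/residue/allTouch` and their lemmas, which depend on `Λ₀` and `a`
alone). [cite: Ruelle1969GroundState, §2 (the lattice ℤ^ν and its sublattices)] -/
abbrev sk : KrausPattern d where
  Λ₀ := P.Λ₀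
  m := 1
  V := fun _ => 1
  a := P.a
  sum_conjTranspose_mul := by
    rw [Fin.sum_univ_one, Matrix.conjTranspose_one, Matrix.one_mul]
  homogeneous := fun _ => Or.inl (map_one _)
  sub_lt := P.sub_lt

/-- **The Kraus operator `V_k` placed at the translate `x + Λ₀ ⊆ Λ'`**: `Γ(τ_x V_k) ∈ 𝔄_{Λ'}`.
[cite: BratteliRobinsonII1997, §6.2.1 (translates of local algebras, isotony)] -/
def placed (x : Site d) {Λ' : Finset (Site d)} (h : shiftSet x P.Λ₀ ⊆ Λ') (k : Fin P.m) : Op ↥Λ' q :=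
  embedOp h (transportOp (siteShiftEquiv x P.Λ₀) (P.V k))

/-- The placed Kraus family is complete: `Σ_k (ΓτV_k)⋆ (ΓτV_k) = 𝟙`.
[cite: BratteliKishimotoRobinson1978, Thm. 1 (proof)] -/
theorem sum_conjTranspose_placed_mul (x : Site d) {Λ' : Finset (Site d)} (h : shiftSet x P.Λ₀ ⊆ Λ') :
    ∑ k, (P.placed x h k)ᴴ * P.placed x h k = 1 := by
  simp only [placed]
  simp_rw [← embedOp_conjTranspose, ← embedOp_mul, ← transportOp_conjTranspose, ← transportOp_mul]
  rw [← embedOp_sum]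
  simp_rw [transportOp_eq_reindexAlgEquiv]
  rw [← map_sum, P.sum_conjTranspose_mul, map_one, embedOp_one]

/-- Placements are compatible with further isotony: `Γ_{Λ'⊆Λ''}(placed_{Λ'}) = placed_{Λ''}`.
[cite: BratteliRobinsonII1997, §6.2.1 (isotony)] -/
theorem embedOp_placed {x : Site d} {Λ' Λ'' : Finset (Site d)} (hΛ : Λ' ⊆ Λ'') (h : shiftSet x P.Λ₀ ⊆ Λ')
    (k : Fin P.m) : embedOp hΛ (P.placed x h k) = P.placed x (h.trans hΛ) k := by
  rw [placed, placed, embedOp_embedOp]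

/-- **Locality**: a placed Kraus operator commutes with every observable of a region disjoint from its
translate. [cite: BratteliRobinsonII1997, §6.2.1 (locality)] -/
theorem commute_placed_embedOp_of_disjoint {x : Site d} {Λ Λ' : Finset (Site d)} (h : shiftSet x P.Λ₀ ⊆ Λ')
    (hΛ : Λ ⊆ Λ') (hd : Disjoint (shiftSet x P.Λ₀) Λ) (k : Fin P.m) (A : Op ↥Λ q) :
    Commute (P.placed x h k) (embedOp hΛ A) :=
  commute_embedOp_of_disjoint h hΛ hd _ _

/-- **Locality**: Kraus operators placed at disjoint translates commute.
[cite: BratteliRobinsonII1997, §6.2.1 (locality)] -/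
theorem commute_placed_placed_of_disjoint {x x' : Site d} {Λ' : Finset (Site d)} (h : shiftSet x P.Λ₀ ⊆ Λ')
    (h' : shiftSet x' P.Λ₀ ⊆ Λ') (hd : Disjoint (shiftSet x P.Λ₀) (shiftSet x' P.Λ₀)) (k j : Fin P.m) :
    Commute (P.placed x h k) (P.placed x' h' j) :=
  commute_embedOp_of_disjoint h h' hd _ _

/-- **Translation covariance of placements**: translating by `v` the operator `V_k` placed at `x + Λ₀`
(inside `Λ'`) gives `V_k` placed at `x + v + Λ₀` (inside any `Λ'' ⊇ Λ' + v`).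
[cite: BratteliRobinsonII1997, §6.2.1 (eqs. (6.2.2)–(6.2.3))] -/
theorem embedOp_transportOp_placed {x v : Site d} {Λ' Λ'' : Finset (Site d)} (h : shiftSet x P.Λ₀ ⊆ Λ')
    (hS : shiftSet v Λ' ⊆ Λ'') (h' : shiftSet (x + v) P.Λ₀ ⊆ Λ'') (k : Fin P.m) :
    embedOp hS (transportOp (siteShiftEquiv v Λ') (P.placed x h k)) = P.placed (x + v) h' k := by
  rw [placed, placed, transportOp_shiftSet_embedOp, embedOp_embedOp]
  exact embedOp_transportOp_congr (IsSmallTIActivity.shiftSet_shiftSet x v P.Λ₀) _ h'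
    ((siteShiftEquiv x P.Λ₀).trans (siteShiftEquiv v (shiftSet x P.Λ₀))) (siteShiftEquiv (x + v) P.Λ₀)
    (fun y => by simp only [Equiv.trans_apply, coe_siteShiftEquiv_apply, add_assoc]) (P.V k)

end SpinKrausPattern

/-! ### §3. The local maps and their commuting product -/

namespace SpinKrausPattern

variable (P : SpinKrausPattern d q)

/-- **The local Kraus map at the translate `x + Λ₀` inside the region `Λ'`** (the identity if the
translate does not fit inside `Λ'`). [cite: BratteliKishimotoRobinson1978, Thm. 1 (proof, `e^{tγ_B}`)] -/
def localMap (Λ' : Finset (Site d)) (x : Site d) : Module.End ℂ (Op ↥Λ' q) := by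
  classical
  exact if h : shiftSet x P.Λ₀ ⊆ Λ' then krausMapOp (P.placed x h) else 1

/-- `localMap` when the translate fits. [cite: BratteliKishimotoRobinson1978, Thm. 1 (proof)] -/
theorem localMap_of_subset {Λ' : Finset (Site d)} {x : Site d} (h : shiftSet x P.Λ₀ ⊆ Λ') :
    P.localMap Λ' x = krausMapOp (P.placed x h) := by
  classical
  unfold localMap
  exact dif_pos h

/-- `localMap` when the translate does not fit. [cite: BratteliKishimotoRobinson1978, Thm. 1 (proof)] -/
theorem localMap_of_not_subset (P : SpinKrausPattern d q) {Λ' : Finset (Site d)} {x : Site d}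
    (h : ¬ shiftSet x P.Λ₀ ⊆ Λ') : P.localMap Λ' x = 1 := by
  classical
  unfold localMap
  exact dif_neg h

/-- **Local maps at distinct sparse translates commute.** [cite: BratteliRobinsonII1997, §6.2.1 (locality)] -/
theorem commute_localMap {r : Fin d → ZMod P.sk.a} {x x' : Site d} (hx : P.sk.IsSparse r x)
    (hx' : P.sk.IsSparse r x') (Λ' : Finset (Site d)) : Commute (P.localMap Λ' x) (P.localMap Λ' x') := by
  by_cases hxx : x = x'
  · rw [hxx]
  by_cases h : shiftSet x P.Λ₀ ⊆ Λ'
  · by_cases h' : shiftSet x' P.Λ₀ ⊆ Λ'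
    · rw [P.localMap_of_subset h, P.localMap_of_subset h']
      exact krausMapOp_comm fun k j =>
        P.commute_placed_placed_of_disjoint h h' (P.sk.disjoint_shiftSet_of_ne hx hx' hxx) k j
    · rw [P.localMap_of_not_subset h']
      exact Commute.one_right _
  · rw [P.localMap_of_not_subset h]
    exact Commute.one_left _

/-- Pairwise commutation over a set of sparse points. [cite: BratteliRobinsonII1997, §6.2.1 (locality)] -/
theorem pairwise_commute_localMap {r : Fin d → ZMod P.sk.a} {s : Finset (Site d)}
    (hs : ∀ x ∈ s, P.sk.IsSparse r x) (Λ' : Finset (Site d)) :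
    (s : Set (Site d)).Pairwise (fun x x' => Commute (P.localMap Λ' x) (P.localMap Λ' x')) :=
  fun x hx x' hx' _ => P.commute_localMap (hs x hx) (hs x' hx') Λ'

/-- **The sparse perturbation map of the region `Λ`**: the commuting product, over the sparse translates
meeting `Λ`, of the local Kraus maps, acting on the local algebra of the hull.
[cite: BratteliKishimotoRobinson1978, Thm. 2 (proof) and Thm. 1 (proof)] -/
def sparseMap (r : Fin d → ZMod P.sk.a) (Λ : Finset (Site d)) : Module.End ℂ (Op ↥(P.sk.hull r Λ) q) :=
  (P.sk.touch r Λ).noncommProd (P.localMap (P.sk.hull r Λ))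
    (P.pairwise_commute_localMap (fun _ hx => P.sk.isSparse_of_mem_touch hx) _)

/-- A local map fixes `𝟙`. [cite: BratteliKishimotoRobinson1978, Thm. 1 (proof)] -/
theorem localMap_one (P : SpinKrausPattern d q) (Λ' : Finset (Site d)) (x : Site d) :
    P.localMap Λ' x 1 = 1 := by
  by_cases h : shiftSet x P.Λ₀ ⊆ Λ'
  · rw [P.localMap_of_subset h]
    exact krausMapOp_one (P.sum_conjTranspose_placed_mul x h)
  · rw [P.localMap_of_not_subset h, Module.End.one_apply]

open scoped MatrixOrder in
/-- A local map preserves positivity. [cite: BratteliKishimotoRobinson1978, Thm. 1 (proof)] -/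
theorem localMap_nonneg (Λ' : Finset (Site d)) (x : Site d) {B : Op ↥Λ' q} (hB : 0 ≤ B) :
    0 ≤ P.localMap Λ' x B := by
  by_cases h : shiftSet x P.Λ₀ ⊆ Λ'
  · rw [P.localMap_of_subset h]
    exact krausMapOp_nonneg _ hB
  · rwa [P.localMap_of_not_subset h, Module.End.one_apply]

/-- **Covariance of the local maps under inclusions of regions**: for `Λ' ⊆ Λ''` and a translate fitting
inside `Λ'`, `Γ(Λ' ⊆ Λ'') ∘ 𝓔_x^{Λ'} = 𝓔_x^{Λ''} ∘ Γ(Λ' ⊆ Λ'')`. [cite: BratteliKishimotoRobinson1978, Thm. 1 (proof)] -/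
theorem embedOp_localMap {Λ' Λ'' : Finset (Site d)} (hΛ : Λ' ⊆ Λ'') {x : Site d}
    (h : shiftSet x P.Λ₀ ⊆ Λ') (B : Op ↥Λ' q) :
    embedOp hΛ (P.localMap Λ' x B) = P.localMap Λ'' x (embedOp hΛ B) := by
  rw [P.localMap_of_subset h, P.localMap_of_subset (h.trans hΛ), embedOp_krausMapOp]
  simp_rw [P.embedOp_placed hΛ h]

/-- A local map at a translate disjoint from `Λ ⊆ Λ'` fixes the embedded observables of `Λ` (locality).
[cite: BratteliRobinsonII1997, §6.2.1 (locality)] -/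
theorem localMap_embedOp_of_disjoint {Λ Λ' : Finset (Site d)} (hΛ : Λ ⊆ Λ') {x : Site d}
    (hd : Disjoint (shiftSet x P.Λ₀) Λ) (B : Op ↥Λ q) :
    P.localMap Λ' x (embedOp hΛ B) = embedOp hΛ B := by
  by_cases h : shiftSet x P.Λ₀ ⊆ Λ'
  · rw [P.localMap_of_subset h]
    exact krausMapOp_eq_self_of_commute (P.sum_conjTranspose_placed_mul x h)
      fun k => P.commute_placed_embedOp_of_disjoint h hΛ hd k B
  · rw [P.localMap_of_not_subset h, Module.End.one_apply]

/-- The sparse map fixes `𝟙`. [cite: BratteliKishimotoRobinson1978, Thm. 1 (proof)] -/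
theorem sparseMap_one (r : Fin d → ZMod P.sk.a) (Λ : Finset (Site d)) : P.sparseMap r Λ 1 = 1 := by
  unfold sparseMap
  exact noncommProd_apply_eq_self _ _ _ fun x _ => P.localMap_one _ x

open scoped MatrixOrder in
/-- The sparse map preserves positivity. [cite: BratteliKishimotoRobinson1978, Thm. 1 (proof)] -/
theorem sparseMap_nonneg (r : Fin d → ZMod P.sk.a) (Λ : Finset (Site d)) {B : Op ↥(P.sk.hull r Λ) q}
    (hB : 0 ≤ B) : 0 ≤ P.sparseMap r Λ B := by
  unfold sparseMap
  exact noncommProd_apply_induction _ _ _ (fun X => 0 ≤ X) (fun x _ X hX => P.localMap_nonneg _ x hX) B hB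

/-- **The key covariance**: for `Λ ⊆ Λ'`, pushing the sparse map of `Λ` into the hull of `Λ'` gives the
partial product, over `touch Λ`, of the local maps of the bigger hull.
[cite: BratteliKishimotoRobinson1978, Thm. 1 (proof)] -/
theorem embedOp_sparseMap {r : Fin d → ZMod P.sk.a} {Λ Λ' : Finset (Site d)} (h : Λ ⊆ Λ')
    (B : Op ↥(P.sk.hull r Λ) q) :
    embedOp (P.sk.hull_mono r h) (P.sparseMap r Λ B) =
      (P.sk.touch r Λ).noncommProd (P.localMap (P.sk.hull r Λ'))
        (P.pairwise_commute_localMap (fun _ hx => P.sk.isSparse_of_mem_touch hx) _)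
        (embedOp (P.sk.hull_mono r h) B) := by
  unfold sparseMap
  exact apply_noncommProd_apply (fun X => embedOp (P.sk.hull_mono r h) X) _ _ _ _ _
    (fun x hx X => P.embedOp_localMap (P.sk.hull_mono r h) (P.sk.shiftSet_subset_hull hx) X) B

/-- The extra translates of a bigger region fix the embedded image of the hull of the smaller one.
[cite: BratteliRobinsonII1997, §6.2.1 (locality)] -/
theorem noncommProd_sdiff_apply_eq_self {r : Fin d → ZMod P.sk.a} {Λ Λ' : Finset (Site d)} (h : Λ ⊆ Λ')
    (Y : Op ↥(P.sk.hull r Λ) q) (comm) :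
    (P.sk.touch r Λ' \ P.sk.touch r Λ).noncommProd (P.localMap (P.sk.hull r Λ')) comm
        (embedOp (P.sk.hull_mono r h) Y) =
      embedOp (P.sk.hull_mono r h) Y := by
  refine noncommProd_apply_eq_self _ _ _ fun x hx => ?_
  rw [Finset.mem_sdiff] at hx
  exact P.localMap_embedOp_of_disjoint (P.sk.hull_mono r h)
    (P.sk.disjoint_shiftSet_hull (P.sk.isSparse_of_mem_touch hx.1) hx.2) Y

/-! ### §4. The perturbed state -/

/-- **The sparse Kraus perturbation of an infinite-volume state is an infinite-volume state.** For a spin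
Kraus pattern `P`, a residue class `r ∈ (ℤ/aℤ)^d` and a state `ω`:
`(sparseState P r ω)_Λ (B) = ω_{hull Λ}(∏_{x ∈ touch Λ} 𝓔_x (Γ B))`. Normalisation and positivity hold
factor by factor; compatibility along `Λ ⊆ Λ'` because the extra factors fix the observables of `Λ`
(locality). This is the `ω ∘ ∏_x e^{γ_{B_x}}`-type perturbation of Bratteli–Kishimoto–Robinson (proof of
Thm. 1), taken simultaneously along the sparse sublattice `x ≡ r (mod a)` as needed for
translation-invariant comparison states (their Thm. 2 / Ruelle 1969 Thm. 2).
[cite: BratteliKishimotoRobinson1978, Thm. 1 (proof) and Thm. 2] -/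
def sparseState (r : Fin d → ZMod P.sk.a) (ω : InfVolState d q) : InfVolState d q where
  expect Λ :=
    { toFun := fun B => ω.expect (P.sk.hull r Λ) (P.sparseMap r Λ (embedOp (P.sk.subset_hull r Λ) B))
      map_add' := fun B C => by rw [embedOp_add, map_add, map_add]
      map_smul' := fun c B => by rw [embedOp_smul, map_smul, map_smul, RingHom.id_apply] }
  expect_one Λ := by
    change ω.expect _ (P.sparseMap r Λ (embedOp _ 1)) = 1
    rw [embedOp_one, P.sparseMap_one, ω.expect_one]
  expect_nonneg Λ A := by
    open scoped MatrixOrder in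
    change 0 ≤ ω.expect _ (P.sparseMap r Λ (embedOp _ (Aᴴ * A)))
    rw [embedOp_mul, embedOp_conjTranspose]
    exact ω.expect_nonneg_of_nonneg _ (P.sparseMap_nonneg r Λ (star_mul_self_nonneg _))
  compatible Λ Λ' h A := by
    change ω.expect (P.sk.hull r Λ') (P.sparseMap r Λ' (embedOp (P.sk.subset_hull r Λ') (embedOp h A))) =
      ω.expect (P.sk.hull r Λ) (P.sparseMap r Λ (embedOp (P.sk.subset_hull r Λ) A))
    classical
    set Y : Op ↥(P.sk.hull r Λ) q := P.sparseMap r Λ (embedOp (P.sk.subset_hull r Λ) A) with hY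
    rw [← ω.compatible (P.sk.hull_mono r h) Y]
    refine congrArg (ω.expect (P.sk.hull r Λ')) ?_
    -- split the big product along `touch Λ ⊆ touch Λ'`
    have hT : P.sk.touch r Λ' = (P.sk.touch r Λ' \ P.sk.touch r Λ) ∪ P.sk.touch r Λ :=
      (Finset.sdiff_union_of_subset (P.sk.touch_mono r h)).symm
    unfold sparseMap
    rw [Finset.noncommProd_congr hT (fun _ _ => rfl), Finset.noncommProd_union_of_disjoint Finset.sdiff_disjoint,
      Module.End.mul_apply, embedOp_embedOp]
    -- the inner product is the pushed-forward small sparse map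
    have hinner : (P.sk.touch r Λ).noncommProd (P.localMap (P.sk.hull r Λ'))
          ((P.pairwise_commute_localMap (fun _ hx => P.sk.isSparse_of_mem_touch hx) _))
          (embedOp (h.trans (P.sk.subset_hull r Λ')) A) =
        embedOp (P.sk.hull_mono r h) Y := by
      rw [hY, P.embedOp_sparseMap h, embedOp_embedOp]
    rw [hinner, P.noncommProd_sdiff_apply_eq_self h Y]

/-- The local expectations of the sparse perturbation (definitional unfolding).
[cite: BratteliKishimotoRobinson1978, Thm. 1 (proof)] -/
theorem sparseState_expect (r : Fin d → ZMod P.sk.a) (ω : InfVolState d q) (Λ : Finset (Site d)) (B : Op ↥Λ q) :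
    (P.sparseState r ω).expect Λ B =
      ω.expect (P.sk.hull r Λ) (P.sparseMap r Λ (embedOp (P.sk.subset_hull r Λ) B)) := rfl

/-! ### §5. Translation covariance of the sparse perturbation -/

/-- **Covariance of the sparse map**: translating the hull intertwines the sparse map of `Λ` for the class
`r - v̄` with the sparse map of `Λ + v` for the class `r`.
[cite: BratteliKishimotoRobinson1978, Thm. 1 (proof) and Thm. 2] -/
theorem embedOp_transportOp_sparseMap (r : Fin d → ZMod P.sk.a) (v : Site d) (Λ : Finset (Site d))
    (hWW : shiftSet v (P.sk.hull (r - P.sk.residue v) Λ) ⊆ P.sk.hull r (shiftSet v Λ))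
    (Y : Op ↥(P.sk.hull (r - P.sk.residue v) Λ) q) :
    embedOp hWW (transportOp (siteShiftEquiv v (P.sk.hull (r - P.sk.residue v) Λ))
        (P.sparseMap (r - P.sk.residue v) Λ Y)) =
      P.sparseMap r (shiftSet v Λ)
        (embedOp hWW (transportOp (siteShiftEquiv v (P.sk.hull (r - P.sk.residue v) Λ)) Y)) := by
  have hT : P.sk.touch r (shiftSet v Λ) =
      (P.sk.touch (r - P.sk.residue v) Λ).map (Equiv.addRight v).toEmbedding := by
    rw [P.sk.touch_shiftSet]; rfl
  unfold sparseMap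
  rw [Finset.noncommProd_congr hT (fun _ _ => rfl)]
  refine apply_noncommProd_apply_map
    (fun X => embedOp hWW (transportOp (siteShiftEquiv v (P.sk.hull (r - P.sk.residue v) Λ)) X)) _ _ _ _ _ _
    (fun x hx X => ?_) Y
  -- the factor at `x` is carried to the factor at `x + v`
  have hxW : shiftSet x P.Λ₀ ⊆ P.sk.hull (r - P.sk.residue v) Λ := P.sk.shiftSet_subset_hull hx
  have hx' : x + v ∈ P.sk.touch r (shiftSet v Λ) := by
    rw [P.sk.mem_touch_shiftSet, add_sub_cancel_right]; exact hx
  have hxW' : shiftSet (x + v) P.Λ₀ ⊆ P.sk.hull r (shiftSet v Λ) := P.sk.shiftSet_subset_hull hx'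
  change embedOp hWW (transportOp _ (P.localMap _ x X)) = P.localMap _ (x + v) (embedOp hWW (transportOp _ X))
  rw [P.localMap_of_subset hxW, P.localMap_of_subset hxW', embedOp_transportOp_krausMapOp]
  simp_rw [P.embedOp_transportOp_placed hxW hWW hxW']

/-- **Translation covariance of the sparse perturbation.** For a translation-invariant state `ω`:
`(sparseState r ω) ∘ τ_v = sparseState (r - v̄) ω` — translating by `v` the state perturbed along the
sublattice `x ≡ r` gives the state perturbed along `x ≡ r - v̄`.
[cite: BratteliKishimotoRobinson1978, Thm. 2 (translation-invariant interactions and states)] -/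
theorem shift_sparseState (r : Fin d → ZMod P.sk.a) (ω : InfVolState d q) (hωT : ω.IsTranslationInvariant)
    (v : Site d) : (P.sparseState r ω).shift v = P.sparseState (r - P.sk.residue v) ω := by
  refine InfVolState.ext fun Λ => LinearMap.ext fun B => ?_
  rw [InfVolState.shift_expect_shiftSet, sparseState_expect, sparseState_expect]
  -- move the right-hand side into the hull of `Λ + v` using the invariance of `ω`
  set W := P.sk.hull (r - P.sk.residue v) Λ with hW
  have hWW : shiftSet v W ⊆ P.sk.hull r (shiftSet v Λ) := (P.sk.hull_shiftSet r v Λ).symm.subset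
  conv_rhs => rw [← hωT v, InfVolState.shift_expect_shiftSet, ← ω.compatible hWW]
  rw [P.embedOp_transportOp_sparseMap r v Λ hWW, transportOp_shiftSet_embedOp, embedOp_embedOp]

/-! ### §6. The uniform average of finitely many states; the cell average -/

end SpinKrausPattern

namespace InfVolState

variable {β : Type*} [Fintype β] [Nonempty β]

/-- **The uniform average** `|β|⁻¹ Σ_b ω_b` of a finite nonempty family of infinite-volume states (the state
space is convex, Bratteli–Robinson I §2.3.2 / §4.3.1). [cite: BratteliRobinsonI1987, §4.3.1] -/
def avgState (f : β → InfVolState d q) : InfVolState d q where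
  expect Λ := ((Fintype.card β : ℂ)⁻¹) • ∑ b, (f b).expect Λ
  expect_one Λ := by
    have hc : (Fintype.card β : ℂ) ≠ 0 := Nat.cast_ne_zero.2 Fintype.card_ne_zero
    simp only [LinearMap.smul_apply, LinearMap.coe_sum, Finset.sum_apply, expect_one, sum_const,
      Finset.card_univ, nsmul_eq_mul, mul_one, smul_eq_mul]
    exact inv_mul_cancel₀ hc
  expect_nonneg Λ A := by
    simp only [LinearMap.smul_apply, LinearMap.coe_sum, Finset.sum_apply, smul_eq_mul]
    refine mul_nonneg ?_ (sum_nonneg fun b _ => (f b).expect_nonneg Λ A)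
    rw [← Complex.ofReal_natCast, ← Complex.ofReal_inv]
    exact Complex.zero_le_real.2 (inv_nonneg.2 (Nat.cast_nonneg _))
  compatible Λ Λ' h A := by
    simp only [LinearMap.smul_apply, LinearMap.coe_sum, Finset.sum_apply, (f _).compatible h]

/-- The local expectations of the average (definitional). [cite: BratteliRobinsonI1987, §4.3.1] -/
theorem avgState_expect (f : β → InfVolState d q) (Λ : Finset (Site d)) (A : Op ↥Λ q) :
    (avgState f).expect Λ A = ((Fintype.card β : ℂ)⁻¹) * ∑ b, (f b).expect Λ A := by
  simp only [avgState, LinearMap.smul_apply, LinearMap.coe_sum, Finset.sum_apply, smul_eq_mul]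

/-- Translating the average translates every member. [cite: BratteliRobinsonI1987, §4.3.1] -/
theorem shift_avgState (f : β → InfVolState d q) (v : Site d) :
    (avgState f).shift v = avgState fun b => (f b).shift v :=
  InfVolState.ext fun Λ => LinearMap.ext fun A => by
    rw [shift_expect, avgState_expect, avgState_expect]
    rfl

/-- The average is invariant under reindexing the family by a bijection. [cite: BratteliRobinsonI1987, §4.3.1] -/
theorem avgState_comp_equiv (f : β → InfVolState d q) (e : β ≃ β) :
    avgState (f ∘ e) = avgState f :=
  InfVolState.ext fun Λ => LinearMap.ext fun A => by
    rw [avgState_expect, avgState_expect]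
    exact congrArg _ (e.sum_comp (fun b => (f b).expect Λ A))

/-- **The mean energy is affine**: `e_Φ(|β|⁻¹ Σ_b ω_b) = |β|⁻¹ Σ_b e_Φ(ω_b)`.
[cite: BratteliKishimotoRobinson1978, §3 (the mean energy functional is affine)] -/
theorem meanEnergy_avgState (Φ : LatticeInteraction d q) (R : ℝ) (f : β → InfVolState d q) :
    (avgState f).meanEnergy Φ R = (Fintype.card β : ℝ)⁻¹ * ∑ b, (f b).meanEnergy Φ R := by
  simp only [meanEnergy, avgState_expect]
  rw [← Complex.ofReal_natCast, ← Complex.ofReal_inv, Complex.re_ofReal_mul, Complex.re_sum]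

end InfVolState

namespace SpinKrausPattern

variable (P : SpinKrausPattern d q) [NeZero P.sk.a]

/-- **The cell-averaged perturbed state**: the uniform average, over all residue classes `r ∈ (ℤ/aℤ)^d`, of
the sparse perturbations `sparseState r ω` — the state `ω` perturbed at density `a^{-d}` by the local Kraus
map, made translation invariant by averaging over the `a^d` sublattices (the comparison state of the
variational argument). [cite: BratteliKishimotoRobinson1978, Thm. 2 (proof)] -/
def cellState (ω : InfVolState d q) : InfVolState d q :=
  InfVolState.avgState fun r : Fin d → ZMod P.sk.a => P.sparseState r ω

/-- `cellState` unfolded. [cite: BratteliKishimotoRobinson1978, Thm. 2 (proof)] -/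
theorem cellState_expect (ω : InfVolState d q) (Λ : Finset (Site d)) (A : Op ↥Λ q) :
    (P.cellState ω).expect Λ A =
      ((Fintype.card (Fin d → ZMod P.sk.a) : ℂ)⁻¹) * ∑ r : Fin d → ZMod P.sk.a, (P.sparseState r ω).expect Λ A :=
  InfVolState.avgState_expect _ Λ A

/-- **The cell average is translation invariant** (for a translation-invariant `ω`): translating by `v`
permutes the residue classes `r ↦ r - v̄`. [cite: BratteliKishimotoRobinson1978, Thm. 2 (proof: invariant comparison states)] -/
theorem cellState_isTranslationInvariant (ω : InfVolState d q) (hωT : ω.IsTranslationInvariant) :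
    (P.cellState ω).IsTranslationInvariant := by
  intro v
  unfold cellState
  rw [InfVolState.shift_avgState]
  have h : (fun r : Fin d → ZMod P.sk.a => (P.sparseState r ω).shift v) =
      (fun r : Fin d → ZMod P.sk.a => P.sparseState r ω) ∘ (Equiv.subRight (P.sk.residue v)) := by
    funext r
    rw [P.shift_sparseState r ω hωT v]
    rfl
  rw [h, InfVolState.avgState_comp_equiv]

/-- The mean energy of the cell average is the average of the mean energies of the sparse perturbations.
[cite: BratteliKishimotoRobinson1978, §3 (the mean energy functional is affine)] -/
theorem meanEnergy_cellState (Φ : LatticeInteraction d q) (R : ℝ) (ω : InfVolState d q) :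
    (P.cellState ω).meanEnergy Φ R =
      (Fintype.card (Fin d → ZMod P.sk.a) : ℝ)⁻¹ * ∑ r : Fin d → ZMod P.sk.a, (P.sparseState r ω).meanEnergy Φ R :=
  InfVolState.meanEnergy_avgState Φ R _

end SpinKrausPattern

end Literature.MathematicalPhysics.QuantumLattice

end
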